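import Summits.CriticalPhenomena.PercolationContinuityZ3.Theorems.PercNearOneGluingNoHeavyLowerTailSahiCoordinateTwoThirds
import Summits.CriticalPhenomena.PercolationContinuityZ3.Theorems.SahiMasterFamilyZeroFamilies
import Mathlib.Tactic.Linarith
import Mathlib.Tactic.Ring
import HarnessLib

/-!
# `NoHeavyLowerTail` (crux stmt-CriticalPhenomena-4575), master family at ORDER FOUR: the one-coordinate RUNG PIECES of `E_4`, the local step,
# and the typed conjecture (RUNG-4) "`4B₁ ≥ B₀`, `B₂ ≥ 0`, `4B₃ ≥ B₄` at every coordinate" with its reduction to Sahi's `C_4` on product measures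

Support file (seat `prim-masterthm-p1`, gen 7; `--supports stmt-CriticalPhenomena-4575`); three definitions (`rungPiece₁/₂/₃`) and ONE `@[conjecture]` definition
(`FourRung`, an obligation of THIS programme — census-backed, NOT a published fact), no sorry.  Memo
`run/shared/lean/prim/prim-masterthm/FROM-prim-masterthm-p1-g7-CLASS-TANGENT.md` §6.

SETTING (P2's cube vocabulary, as in `…SahiCoordinateBernstein` for `k = 3`).  For four increasing events `U_0..U_3 ⊆ 2^ι`, a product weight `μ_p` and a coordinate `e`,
`s ↦ E_4(μ_{p[e↦s]}; 1_U)` is the QUARTIC `Q = sahiEP (secPoly p e) 4 (1_U) = Σ_{i ≤ 4} c_i s^i` (`sahiE_update_eq_eval`, `natDegree_sahiEP_le`), with `Q(0), Q(1) = E_4` of the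
`e`-sections (`sahiE_update_boolParam_eq_secAt`).  In the degree-4 Bernstein coefficients `B_0..B_4` of `Q`:
  `Q(s) = s³·Q(1) + (1−s)³·Q(0) + s(1−s)·[(1−s)²·r₁ + s(1−s)·r₂ + s²·r₃]`,   `r₁ = 3c₀ + c₁ = 4B₁ − B₀`, `r₂ = 6c₀ + 3c₁ + c₂ = 6B₂`, `r₃ = 3c₀ + 2c₁ + c₂ − c₄ = 4B₃ − B₄`
(`quartic_rung_decomp`, a ring identity) — the three ONE-COORDINATE RUNG PIECES (`rungPiece₁/₂/₃`).  They are exactly the conditions for the "λ = 3 rung"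
`E_4(μ_p) ≥ p_e³·E_4(μ_{p[e↦1]}) + (1−p_e)³·E_4(μ_{p[e↦0]})`, the order-4 analogue of bnk-2's two-level laws `3B₁ ≥ B₀`, `3B₂ ≥ B₃` (the λ = 2 rung at `k = 3`).

* `sahiE_four_decomp_coord` — the decomposition of `E_4(μ_p; U)` along `e`;
* **`sahiE_four_nonneg_of_rungAt`** — THE LOCAL STEP: `r₁, r₂, r₃ ≥ 0` at ONE coordinate + `E_4 ≥ 0` for the two `e`-sections ⟹ `E_4(μ_p; U) ≥ p_e³·E_4(U¹) + (1−p_e)³·E_4(U⁰) ≥ 0`;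
* `FourRung` — **CONJECTURE (RUNG-4)**: the three rung pieces are `≥ 0` at EVERY coordinate of EVERY increasing quadruple.  CENSUS (this seat, exact integer comb arithmetic,
  engine code-g7/census5/quart.c): ALL quadruples of increasing events on `≤ 4` coordinates (24 133 200 tuples mod the symmetry of the first member, kit j150454),
  every axis and every tensor-Bernstein fibre, and a structured-random 1.8·10⁶ sample on 5 coordinates (kit j150456): 0 violations (comb positivity of `E_4` likewise);
  the λ = 1 top law `4B₃ ≥ 3B₄` (P2's refuted (MT-4)) holds on `≤ 4` coordinates and FAILS in the 5-coordinate sample, as it must;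
* **`masterFamilyNonneg_four_of_fourRung : FourRung → MasterFamilyNonneg 4`** — Sahi's `C_4` for product measures from (RUNG-4), by induction on a determining set.
The same file serves the 4-co-sunflower class (AT_4 ⟹ 4PT-LB) in the companion `…SahiCoSunflowerFourRung`.
HONEST FRAMING: a typed conjecture and its consequence; Sahi's `C_4` and (RUNG-4) remain OPEN.  Axioms standard. [this work]
-/

noncomputable section

open scoped Classical

namespace Summit.CriticalPhenomena.PercolationContinuityZ3.Theorems

namespace SahiCoordinateQuarticRung

open Finset Function Polynomial
open Literature.Combinatorics.Sahi2008
open Literature.Probability.Percolation (DeterminedBy determinedBy_iff)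
open Literature.Probability.Percolation.DecisionTree (ind ind_of_mem ind_of_not_mem ind_nonneg)

/-! ### 1. The quartic decomposition -/

/-- **A quartic through its endpoint values and three rung pieces**: for `deg Q ≤ 4`,
`Q(s) = s³Q(1) + (1−s)³Q(0) + s(1−s)[(1−s)²(3c₀+c₁) + s(1−s)(6c₀+3c₁+c₂) + s²(3c₀+2c₁+c₂−c₄)]`. [this work] -/
theorem quartic_rung_decomp (Q : ℝ[X]) (hQ : Q.natDegree ≤ 4) (s : ℝ) :
    Q.eval s = s ^ 3 * Q.eval 1 + (1 - s) ^ 3 * Q.eval 0 +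
      s * (1 - s) * ((1 - s) ^ 2 * (3 * Q.coeff 0 + Q.coeff 1) + s * (1 - s) * (6 * Q.coeff 0 + 3 * Q.coeff 1 + Q.coeff 2)
        + s ^ 2 * (3 * Q.coeff 0 + 2 * Q.coeff 1 + Q.coeff 2 - Q.coeff 4)) := by
  have hrep : ∀ x : ℝ, Q.eval x = Q.coeff 0 + Q.coeff 1 * x + Q.coeff 2 * x ^ 2 + Q.coeff 3 * x ^ 3 + Q.coeff 4 * x ^ 4 := by
    intro x
    conv_lhs => rw [Q.as_sum_range_C_mul_X_pow' (show Q.natDegree < 5 by omega)]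
    simp only [Finset.sum_range_succ, Finset.sum_range_zero, eval_add, eval_mul, eval_C, eval_pow, eval_X, zero_add]
    ring
  rw [hrep s, hrep 0, hrep 1]
  ring

variable {ι : Type} [Fintype ι]

/-- **First rung piece** `r₁(e) = 3c₀ + c₁ = 4B₁ − B₀`. [this work] -/
def rungPiece₁ (p : ι → unitInterval) (e : ι) (U : Fin 4 → Set (Set ι)) : ℝ :=
  3 * (sahiEP (secPoly p e) 4 (fun j => ind (U j))).coeff 0 + (sahiEP (secPoly p e) 4 (fun j => ind (U j))).coeff 1

/-- **Second rung piece** `r₂(e) = 6c₀ + 3c₁ + c₂ = 6B₂`. [this work] -/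
def rungPiece₂ (p : ι → unitInterval) (e : ι) (U : Fin 4 → Set (Set ι)) : ℝ :=
  6 * (sahiEP (secPoly p e) 4 (fun j => ind (U j))).coeff 0 + 3 * (sahiEP (secPoly p e) 4 (fun j => ind (U j))).coeff 1
    + (sahiEP (secPoly p e) 4 (fun j => ind (U j))).coeff 2

/-- **Third rung piece** `r₃(e) = 3c₀ + 2c₁ + c₂ − c₄ = 4B₃ − B₄`. [this work] -/
def rungPiece₃ (p : ι → unitInterval) (e : ι) (U : Fin 4 → Set (Set ι)) : ℝ :=
  3 * (sahiEP (secPoly p e) 4 (fun j => ind (U j))).coeff 0 + 2 * (sahiEP (secPoly p e) 4 (fun j => ind (U j))).coeff 1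
    + (sahiEP (secPoly p e) 4 (fun j => ind (U j))).coeff 2 - (sahiEP (secPoly p e) 4 (fun j => ind (U j))).coeff 4

/-- The fibre quartic at the boundary `s = b ∈ {0,1}` is `E_4` of the `b`-sections under the ORIGINAL measure. [this work] -/
theorem eval_fibre_boolParam_four (p : ι → unitInterval) (e : ι) (b : Bool) (U : Fin 4 → Set (Set ι)) :
    (sahiEP (secPoly p e) 4 (fun j => ind (U j))).eval ((boolParam b : unitInterval) : ℝ) =
      sahiE (bernoulliWeight p) 4 (fun j => ind (secAt e b (U j))) := by
  rw [← sahiE_update_eq_eval, sahiE_update_boolParam_eq_secAt, sahiE_secAt_update_eq p e b (boolParam b) (p e), update_eq_self]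

/-- **ONE-COORDINATE DECOMPOSITION of `E_4` under a product measure**:
`E_4(μ_p; U) = p_e³·E_4(U^{e←1}) + (1−p_e)³·E_4(U^{e←0}) + p_e(1−p_e)·[(1−p_e)²·r₁ + p_e(1−p_e)·r₂ + p_e²·r₃]`. [this work] -/
theorem sahiE_four_decomp_coord (p : ι → unitInterval) (e : ι) (U : Fin 4 → Set (Set ι)) :
    sahiE (bernoulliWeight p) 4 (fun j => ind (U j)) =
      (p e : ℝ) ^ 3 * sahiE (bernoulliWeight p) 4 (fun j => ind (secAt e true (U j)))
      + (1 - (p e : ℝ)) ^ 3 * sahiE (bernoulliWeight p) 4 (fun j => ind (secAt e false (U j)))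
      + (p e : ℝ) * (1 - (p e : ℝ)) * ((1 - (p e : ℝ)) ^ 2 * rungPiece₁ p e U + (p e : ℝ) * (1 - (p e : ℝ)) * rungPiece₂ p e U
          + (p e : ℝ) ^ 2 * rungPiece₃ p e U) := by
  have h0 := eval_fibre_boolParam_four p e false U
  have h1 := eval_fibre_boolParam_four p e true U
  have hb0 : ((boolParam false : unitInterval) : ℝ) = 0 := by simp [boolParam]
  have hb1 : ((boolParam true : unitInterval) : ℝ) = 1 := by simp [boolParam]
  rw [hb0] at h0
  rw [hb1] at h1
  have hdeg : (sahiEP (secPoly p e) 4 (fun j => ind (U j))).natDegree ≤ 4 :=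
    natDegree_sahiEP_le (secPoly p e) (natDegree_secPoly_le p e) 4 _
  have hmain := quartic_rung_decomp _ hdeg (p e : ℝ)
  rw [h0, h1, ← sahiE_update_eq_eval, update_eq_self] at hmain
  rw [hmain, rungPiece₁, rungPiece₂, rungPiece₃]

/-! ### 2. The local step -/

/-- **THE LOCAL STEP (λ = 3 rung).**  If the three rung pieces at `e` are `≥ 0` and both `e`-sections have `E_4 ≥ 0`, then
`E_4(μ_p; U) ≥ p_e³·E_4(U^{e←1}) + (1−p_e)³·E_4(U^{e←0}) ≥ 0`. [this work] -/
theorem sahiE_four_nonneg_of_rungAt (p : ι → unitInterval) (e : ι) (U : Fin 4 → Set (Set ι))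
    (h1 : 0 ≤ rungPiece₁ p e U) (h2 : 0 ≤ rungPiece₂ p e U) (h3 : 0 ≤ rungPiece₃ p e U)
    (hsec0 : 0 ≤ sahiE (bernoulliWeight p) 4 (fun j => ind (secAt e false (U j))))
    (hsec1 : 0 ≤ sahiE (bernoulliWeight p) 4 (fun j => ind (secAt e true (U j)))) :
    0 ≤ sahiE (bernoulliWeight p) 4 (fun j => ind (U j)) := by
  rw [sahiE_four_decomp_coord p e U]
  have ht0 : 0 ≤ (p e : ℝ) := (p e).2.1
  have ht1' : (p e : ℝ) ≤ 1 := (p e).2.2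
  have ht1 : 0 ≤ 1 - (p e : ℝ) := by linarith
  have hmix : 0 ≤ (1 - (p e : ℝ)) ^ 2 * rungPiece₁ p e U + (p e : ℝ) * (1 - (p e : ℝ)) * rungPiece₂ p e U
      + (p e : ℝ) ^ 2 * rungPiece₃ p e U :=
    add_nonneg (add_nonneg (mul_nonneg (pow_nonneg ht1 2) h1) (mul_nonneg (mul_nonneg ht0 ht1) h2)) (mul_nonneg (pow_nonneg ht0 2) h3)
  exact add_nonneg (add_nonneg (mul_nonneg (pow_nonneg ht0 3) hsec1) (mul_nonneg (pow_nonneg ht1 3) hsec0))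
    (mul_nonneg (mul_nonneg ht0 ht1) hmix)

/-! ### 3. The conjecture, typed, and its reduction to `C_4` -/

/-- **CONJECTURE (RUNG-4)**, an obligation of this programme (NOT a published fact): for every finite cube, every product weight `p`, every four increasing
events `U_0..U_3` and EVERY coordinate `e`, the three one-coordinate rung pieces of `E_4` are nonnegative: `4B₁(e) ≥ B₀(e)`, `B₂(e) ≥ 0`, `4B₃(e) ≥ B₄(e)`
(`rungPiece₁/₂/₃ ≥ 0`).  Census: exhaustive on `≤ 4` coordinates (24 133 200 tuples, kit j150454), 1.8·10⁶ structured-random quadruples on 5 coordinates (kit j150456),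
0 violations (memo §6).  Implies Sahi's `C_4` for product measures (`masterFamilyNonneg_four_of_fourRung`).
[cite: Sahi2008, Conj. 5 (p. 212); LiebSahi2021, Conj. 1.1] [status: open] -/
@[conjecture] def FourRung : Prop :=
  ∀ (ι : Type) [Fintype ι] (p : ι → unitInterval) (U : Fin 4 → Set (Set ι)), (∀ j, IsUpperSet (U j)) →
    ∀ e : ι, 0 ≤ rungPiece₁ p e U ∧ 0 ≤ rungPiece₂ p e U ∧ 0 ≤ rungPiece₃ p e U

/-- **(RUNG-4) ⟹ Sahi's `C_4` for product measures** (induction on the size of a determining set: the sections of an increasing quadruple are increasing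
quadruples determined by one coordinate fewer; a quadruple determined by no coordinate is a zero flag). [this work] -/
theorem masterFamilyNonneg_four_of_fourRung (hR : FourRung) : MasterFamilyNonneg 4 := by
  intro κ _ p U hU
  suffices key : ∀ (m : ℕ) (V : Fin 4 → Set (Set κ)) (S : Finset κ), S.card = m → (∀ j, IsUpperSet (V j)) →
      (∀ j, DeterminedBy (V j) (↑S : Set κ)) → 0 ≤ sahiE (bernoulliWeight p) 4 (fun j => ind (V j)) from
    key _ U Finset.univ rfl hU fun j => (determinedBy_iff _ _).2 fun ω ω' h => by
      rw [Finset.coe_univ, Set.inter_univ, Set.inter_univ] at h; rw [h]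
  intro m
  induction m using Nat.strong_induction_on with
  | _ m ih =>
  intro V S hS hV hVS
  rcases S.eq_empty_or_nonempty with hSe | hSne
  · subst hSe
    exact (masterFamilyEqIff_mpr 4 κ p V
      (suppZeroFlag_of_pairwise_disjoint 2 V (fun _ => ∅) (fun _ _ _ => disjoint_bot_left) hVS)).ge
  · obtain ⟨e, heS⟩ := hSne
    have hlt : (S.erase e).card < m := by rw [← hS]; exact Finset.card_erase_lt_of_mem heS
    have E0 := ih _ hlt (fun j => secAt e false (V j)) (S.erase e) rfl (fun j => isUpperSet_secAt e false (hV j))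
      (fun j => determinedBy_secAt e false (hVS j))
    have E1 := ih _ hlt (fun j => secAt e true (V j)) (S.erase e) rfl (fun j => isUpperSet_secAt e true (hV j))
      (fun j => determinedBy_secAt e true (hVS j))
    obtain ⟨h1, h2, h3⟩ := hR κ p V hV e
    exact sahiE_four_nonneg_of_rungAt p e V h1 h2 h3 E0 E1

end SahiCoordinateQuarticRung

end Summit.CriticalPhenomena.PercolationContinuityZ3.Theorems
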